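import Summits.CriticalPhenomena.Ising3DConformalLimit.Theorems.FKParityRobustnessIndependentStrandsJoinCrossFatteningDefs
import Summits.CriticalPhenomena.Ising3DConformalLimit.Theorems.FKParityRobustnessIndependentStrandsJoinStubBubbleLattice
import Summits.CriticalPhenomena.Ising3DConformalLimit.Theorems.FKParityRobustnessLatticeBoundFromStrands
import HarnessLib

/-!
# Crux `IndependentStrandsJoin` (stmt-CriticalPhenomena-14625), line `cross-fattening-decoupling` —
# stub `stub_bubble`, Step B: box transfer and the conditional stub `stub_bubble_of_etaBounds`

Route `FKParityRobustness`, sub-problem `Ising3DConformalLimit`; registered stub `stub_bubble` of the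
skeleton `Cruxes/IndependentStrandsJoin/Lines/cross_fattening_decoupling.lean` (h6 of
`IndependentStrandsJoin_of`), over the line's vocabulary
`Theorems/FKParityRobustnessIndependentStrandsJoinCrossFatteningDefs.lean` (`zPair`, `profile`,
`treePair`, `bubbleSum`, `window`).  The registered statement is, in the box `Λ_N ⊂ ℤ³` at `β_c` with
`Z^B = loopO1PartitionFunction`, `a = l·tetra`, `B_l = window N l`:

  `∃ C > 0, ∀ l ≥ 1, ∃ N₀, ∀ N ≥ N₀: Z^{a₀a₁} · Z^{a₂a₃} · bubbleSum ≤ C · profile²`,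

i.e. (dividing by `(Z^∅)⁸`) the window bubble of the two ADC tree diagrams is dominated by the squared
double-current window profile.  Unconditionally this is an OPEN two-sided regularity problem for the
critical two-point function of `ℤ³`; this file lands it CONDITIONALLY on the named fact
`Literature.Probability.LatticeModels.HasIsingEtaBounds 3 η` with `0 ≤ η < 1/2`
(`stub_bubble_of_etaBounds`; conclusion = the registered statement verbatim).

**Proof (Step B, box transfer).**  Step A (`bubble_lattice`, file `…StubBubbleLattice.lean`) gives the
`ℤ³` inequality `2·K(A₀,A₁)K(A₂,A₃)·B_∞(l) ≤ C·S_∞(l)²` with `S_∞(l) > 0` for the kernel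
`K(x,y) = ⟨σ_xσ_y⟩_{β_c} = criticalTwoPoint 3 (y-x)`.  In the box, `zPair x y = Z^∅ · K_N(x,y)` with the box
ratio `K_N(x,y) = ⟨σ_xσ_y⟩^free_{Λ_N,β_c}` for `x ≠ y` (`twoPoint_eq_loopO1_div`, `twoPoint_boxComap`) and
`K_N(x,x) = 1` (`{x} ∆ {x} = ∅`) — `bubble_zPair_eq`; each `K_N(x,y) → K(x,y)` as `N → ∞`
(`criticalCorr_wellDefined_holds`, `bubble_tendsto_kernel`), so the finitely many window sums converge,
and since Step A has room `2` and `S_∞ > 0` the inequality `K_NK_N·B_N ≤ C·S_N²` holds for `N ≥ N₀(l)`;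
multiplying by `(Z^∅)⁸` and identifying the window (`bubble_window_map`: `window N l ↔ Λ_{⌊l/2⌋}`) gives the
registered shape with the `l`-independent `C` of Step A.

Theorem-only file; helpers carry the prefix `bubble_`.

References: M. Aizenman, H. Duminil-Copin, Ann. of Math. 194 (2021), arXiv:1912.07973, §4 and Lemma 4.4
[AizenmanDuminilCopinAnnals2021]; S. Friedli, Y. Velenik, CUP 2017, §3.7.3 (`⟨σ_xσ_y⟩ = Z^{xy}/Z^∅`)
[FriedliVelenik2017]; M. Aizenman, H. Duminil-Copin, V. Sidoravicius, CMP 334 (2015) (continuity at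
`β_c`, behind `criticalCorr_wellDefined_holds`) [AizenmanDuminilCopinSidoraviciusCMP2015].
-/

noncomputable section

open Finset Filter Topology
open Literature.Probability.LatticeModels
open Summit.CriticalPhenomena.Ising3DConformalLimit.Cruxes.ParityRobustMerging.PlaquetteXorSurgery
  (tetra tetra_injective tanh_criticalBeta_nonneg)
open Summit.CriticalPhenomena.Ising3DConformalLimit.Cruxes.IndependentStrandsJoin.CrossFatteningDecoupling
open Summit.CriticalPhenomena.Ising3DConformalLimit.FKParityRobustnessLatticeBoundFromStrands
  (twoPoint_eq_loopO1_div twoPoint_boxComap twoPoint_eq_isingExpect_spinMonomial)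

namespace Summit.CriticalPhenomena.Ising3DConformalLimit.Theorems

open scoped symmDiff

/-! ### The box ratio kernel and its limit -/

/-- The box ratios converge: `K_N(x,y) → ⟨σ_xσ_y⟩_{β_c} = criticalTwoPoint 3 (y - x)`, where
`K_N(x,y) = ⟨σ_xσ_y⟩^free_{Λ_N,β_c}` for `x ≠ y` (free box limits, `criticalCorr_wellDefined_holds`,
`d = 3`, and translation invariance `criticalCorr_two_pair`) and `K_N(x,x) = 1 = ⟨σ₀σ₀⟩_{β_c}`. -/
theorem bubble_tendsto_kernel (x y : Site 3) :
    Tendsto (fun N : ℕ => if x = y then (1 : ℝ) else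
      isingExpect (zdGraph 3) (box 3 N) (criticalBeta 3) 0 .free (spinMonomial ![x, y]))
      atTop (𝓝 (criticalTwoPoint 3 (y - x))) := by
  by_cases hxy : x = y
  · subst hxy
    simp only [if_true, sub_self, criticalTwoPoint_zero']
    exact tendsto_const_nhds
  · simp only [if_neg hxy, ← criticalCorr_two_pair]
    have hfree : (BoundaryCondition.free : BoundaryCondition (Site 3)) ∈
        ({.free, .plus, .minus} : Set (BoundaryCondition (Site 3))) := by simp
    exact criticalCorr_wellDefined_holds (d := 3) le_rfl 2 ![x, y] .free hfree

/-- The pair partition function of the box graph is `Z^∅` times the box ratio: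
`zPair x y = Z^{{x}∆{y}} = Z^∅ · K_N(x,y)`, with `K_N(x,y) = ⟨σ_xσ_y⟩^free_{Λ_N} = Z^{xy}/Z^∅` for `x ≠ y`
(`twoPoint_eq_loopO1_div` on the induced graph, transported by `twoPoint_boxComap`) and `K_N(x,x) = 1`
(`{x} ∆ {x} = ∅`). -/
theorem bubble_zPair_eq {N : ℕ} (x y : ↥(box 3 N)) :
    zPair ((zdGraph 3).comap (Subtype.val : ↥(box 3 N) → Site 3)) (Real.tanh (criticalBeta 3)) x y =
      loopO1PartitionFunction ((zdGraph 3).comap (Subtype.val : ↥(box 3 N) → Site 3))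
          (Real.tanh (criticalBeta 3)) ∅ *
        (if (x : Site 3) = y then 1 else
          isingExpect (zdGraph 3) (box 3 N) (criticalBeta 3) 0 .free
            (spinMonomial ![(x : Site 3), y])) := by
  by_cases hxy : x = y
  · subst hxy
    rw [if_pos rfl, mul_one, zPair, symmDiff_self, Finset.bot_eq_empty]
  · have hne : (x : Site 3) ≠ y := fun h => hxy (Subtype.ext h)
    have hβ : 0 ≤ criticalBeta 3 := criticalBeta_nonneg 3
    have hZ : 0 < loopO1PartitionFunction ((zdGraph 3).comap (Subtype.val : ↥(box 3 N) → Site 3))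
        (Real.tanh (criticalBeta 3)) ∅ :=
      loopO1PartitionFunction_empty_pos _ tanh_criticalBeta_nonneg
    have h := twoPoint_eq_loopO1_div (G := (zdGraph 3).comap (Subtype.val : ↥(box 3 N) → Site 3))
      hβ hxy
    rw [twoPoint_boxComap, twoPoint_eq_isingExpect_spinMonomial] at h
    rw [if_neg hne, zPair, Current.symmDiff_singleton_eq_pair hxy, h, mul_div_cancel₀ _ hZ.ne']

/-- The window `B_l = {u ∈ Λ_N : 2|uᵢ| ≤ l}` is (the image in `Λ_N` of) the box `Λ_{⌊l/2⌋}` once `l ≤ N`. -/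
theorem bubble_window_map {l N : ℕ} (h : l ≤ N) :
    (window N l).map (Function.Embedding.subtype (· ∈ box 3 N)) = box 3 (l / 2) := by
  ext z
  unfold window
  simp only [Finset.mem_map, Finset.mem_filter, Finset.mem_univ, true_and,
    Function.Embedding.coe_subtype, Subtype.exists, mem_box, exists_prop]
  constructor
  · rintro ⟨u, -, hul, rfl⟩ i
    have h1 := hul i
    have h2 := le_abs_self (u i)
    have h3 := neg_abs_le (u i)
    constructor <;> omega
  · intro hz
    refine ⟨z, fun i => ?_, fun i => ?_, rfl⟩
    · obtain ⟨h1, h2⟩ := hz i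
      constructor <;> omega
    · obtain ⟨h1, h2⟩ := hz i
      have h3 : |z i| ≤ ((l / 2 : ℕ) : ℤ) := abs_le.2 ⟨h1, h2⟩
      omega

/-! ### The conditional stub -/

/-- **Stub `stub_bubble` of the line `cross-fattening-decoupling` (crux `IndependentStrandsJoin`,
stmt-CriticalPhenomena-14625), CONDITIONAL on two-sided two-point regularity
`HasIsingEtaBounds 3 η` with `0 ≤ η < 1/2`** (ADC 2021 Assumption 4.1 in `d = 3`; the conclusion is
the registered statement verbatim): in the box `Λ_N` at `β_c`, for `a = l·tetra` and all `N ≥ N₀(l)`,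
`Z^{a₀a₁}·Z^{a₂a₃}·Σ_{v,w ∈ B_l} tree₁(v,w)tree₂(v,w) ≤ C·(Σ_{u ∈ B_l} Z(a₀u)Z(ua₁)Z(a₂u)Z(ua₃))²`
with ONE constant `C` for all `l ≥ 1` — the tetrahedral window bubble converges at the scale of the
squared window mean.  Step A (`bubble_lattice`) on `ℤ³` plus the box transfer of this file. -/
theorem stub_bubble_of_etaBounds :
    ∀ {η : ℝ}, HasIsingEtaBounds 3 η → 0 ≤ η → η < 1 / 2 →
    ∃ C : ℝ, 0 < C ∧ ∀ l : ℕ, 1 ≤ l → ∃ N₀ : ℕ, ∀ N : ℕ, N₀ ≤ N → ∀ a : Fin 4 → ↥(box 3 N),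
      (∀ i, ((a i : Site 3)) = (l : ℤ) • tetra i) →
      (let G := ((zdGraph 3).comap (Subtype.val : ↥(box 3 N) → Site 3));
       let t : ℝ := Real.tanh (criticalBeta 3);
       loopO1PartitionFunction G t {a 0, a 1} * loopO1PartitionFunction G t {a 2, a 3} *
           bubbleSum G t a (window N l)
         ≤ C * profile G t a (window N l) ^ 2) := by
  intro η hη hη0 hη2
  obtain ⟨K, hKdef⟩ : ∃ K : ℕ → Site 3 → Site 3 → ℝ, ∀ N x y, K N x y =
      if x = y then (1 : ℝ) else
        isingExpect (zdGraph 3) (box 3 N) (criticalBeta 3) 0 .free (spinMonomial ![x, y]) :=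
    ⟨_, fun _ _ _ => rfl⟩
  obtain ⟨Kc, hKc⟩ : ∃ Kc : Site 3 → Site 3 → ℝ, ∀ x y, Kc x y = criticalTwoPoint 3 (y - x) :=
    ⟨fun x y => criticalTwoPoint 3 (y - x), fun _ _ => rfl⟩
  obtain ⟨C, hC, hA⟩ := bubble_lattice hη hη0 hη2 hKc
  refine ⟨C, hC, fun l hl => ?_⟩
  obtain ⟨A, hAdef⟩ : ∃ A : Fin 4 → Site 3, ∀ i, A i = (l : ℤ) • tetra i := ⟨_, fun _ => rfl⟩
  obtain ⟨hSpos, hineq⟩ := hA l hl A hAdef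
  set W : Finset (Site 3) := box 3 (l / 2) with hW
  obtain ⟨FS, hFS⟩ : ∃ FS : (Site 3 → Site 3 → ℝ) → ℝ, ∀ k, FS k =
      ∑ u ∈ W, k (A 0) u * k u (A 1) * (k (A 2) u * k u (A 3)) := ⟨_, fun _ => rfl⟩
  obtain ⟨FB, hFB⟩ : ∃ FB : (Site 3 → Site 3 → ℝ) → ℝ, ∀ k, FB k =
      ∑ v ∈ W, ∑ w ∈ W, (k (A 0) v * k v w * k w (A 1) + k (A 0) w * k w v * k v (A 1)) *
        (k (A 2) v * k v w * k w (A 3) + k (A 2) w * k w v * k v (A 3)) := ⟨_, fun _ => rfl⟩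
  have hineq' : 2 * (Kc (A 0) (A 1) * Kc (A 2) (A 3) * FB Kc) ≤ C * FS Kc ^ 2 := by
    rw [hFB, hFS]; exact hineq
  have hSpos' : 0 < FS Kc := by rw [hFS]; exact hSpos
  -- the finitely many box ratios converge, hence so do the window sums
  have hlim : ∀ x y, Tendsto (fun N => K N x y) atTop (𝓝 (Kc x y)) := fun x y => by
    simp only [hKdef, hKc]; exact bubble_tendsto_kernel x y
  have hS : Tendsto (fun N => FS (K N)) atTop (𝓝 (FS Kc)) := by
    simp only [hFS]
    exact tendsto_finsetSum _ fun u _ => ((hlim _ _).mul (hlim _ _)).mul ((hlim _ _).mul (hlim _ _))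
  have hBt : Tendsto (fun N => FB (K N)) atTop (𝓝 (FB Kc)) := by
    simp only [hFB]
    exact tendsto_finsetSum _ fun v _ => tendsto_finsetSum _ fun w _ =>
      ((((hlim _ _).mul (hlim _ _)).mul (hlim _ _)).add (((hlim _ _).mul (hlim _ _)).mul (hlim _ _))).mul
      ((((hlim _ _).mul (hlim _ _)).mul (hlim _ _)).add (((hlim _ _).mul (hlim _ _)).mul (hlim _ _)))
  have hgap : Tendsto (fun N => C * FS (K N) ^ 2 - K N (A 0) (A 1) * K N (A 2) (A 3) * FB (K N)) atTop
      (𝓝 (C * FS Kc ^ 2 - Kc (A 0) (A 1) * Kc (A 2) (A 3) * FB Kc)) :=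
    ((hS.pow 2).const_mul C).sub (((hlim _ _).mul (hlim _ _)).mul hBt)
  have hpos : 0 < C * FS Kc ^ 2 - Kc (A 0) (A 1) * Kc (A 2) (A 3) * FB Kc := by
    have : 0 < C * FS Kc ^ 2 := by positivity
    linarith
  obtain ⟨N₁, hN₁⟩ := Filter.eventually_atTop.1 (hgap.eventually_const_lt hpos)
  refine ⟨max N₁ l, fun N hN a ha => ?_⟩
  have hN₁N : N₁ ≤ N := le_of_max_le_left hN
  have hlN : l ≤ N := le_of_max_le_right hN
  have key : K N (A 0) (A 1) * K N (A 2) (A 3) * FB (K N) ≤ C * FS (K N) ^ 2 := by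
    have := hN₁ N hN₁N; linarith
  dsimp only
  set G : SimpleGraph ↥(box 3 N) := (zdGraph 3).comap (Subtype.val : ↥(box 3 N) → Site 3) with hG
  set t : ℝ := Real.tanh (criticalBeta 3) with ht
  set Z0 : ℝ := loopO1PartitionFunction G t ∅ with hZ0
  -- `zPair = Z^∅ · K_N`, the two source pairs, and the window sums in `Site 3` coordinates
  have hz : ∀ x y : ↥(box 3 N), zPair G t x y = Z0 * K N x y := fun x y => by
    rw [hKdef]; exact bubble_zPair_eq x y
  have ha' : ∀ i, ((a i : Site 3)) = A i := fun i => (ha i).trans (hAdef i).symm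
  have hinj : Function.Injective a := tetra_injective hl a ha
  have h01 : loopO1PartitionFunction G t {a 0, a 1} = Z0 * K N (A 0) (A 1) := by
    rw [← Current.symmDiff_singleton_eq_pair (hinj.ne (by decide : (0 : Fin 4) ≠ 1)), ← ha' 0, ← ha' 1]
    exact hz (a 0) (a 1)
  have h23 : loopO1PartitionFunction G t {a 2, a 3} = Z0 * K N (A 2) (A 3) := by
    rw [← Current.symmDiff_singleton_eq_pair (hinj.ne (by decide : (2 : Fin 4) ≠ 3)), ← ha' 2, ← ha' 3]
    exact hz (a 2) (a 3)
  have hWmap : W = (window N l).map (Function.Embedding.subtype (· ∈ box 3 N)) :=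
    (bubble_window_map hlN).symm
  have hprof : profile G t a (window N l) = Z0 ^ 4 * FS (K N) := by
    rw [hFS, hWmap, Finset.sum_map, Finset.mul_sum]
    unfold profile
    refine Finset.sum_congr rfl fun u _ => ?_
    simp only [Function.Embedding.coe_subtype, hz, ha']
    ring
  have hbub : bubbleSum G t a (window N l) = Z0 ^ 6 * FB (K N) := by
    rw [hFB, hWmap]
    simp only [Finset.sum_map, Finset.mul_sum]
    unfold bubbleSum treePair
    refine Finset.sum_congr rfl fun v _ => Finset.sum_congr rfl fun w _ => ?_
    simp only [Function.Embedding.coe_subtype, hz, ha']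
    ring
  -- multiply the ratio inequality by `(Z^∅)⁸`
  have h8 : 0 ≤ Z0 ^ 8 := pow_nonneg (loopO1PartitionFunction_nonneg G tanh_criticalBeta_nonneg ∅) 8
  calc loopO1PartitionFunction G t {a 0, a 1} * loopO1PartitionFunction G t {a 2, a 3} *
        bubbleSum G t a (window N l)
      = Z0 ^ 8 * (K N (A 0) (A 1) * K N (A 2) (A 3) * FB (K N)) := by rw [h01, h23, hbub]; ring
    _ ≤ Z0 ^ 8 * (C * FS (K N) ^ 2) := mul_le_mul_of_nonneg_left key h8
    _ = C * (Z0 ^ 4 * FS (K N)) ^ 2 := by ring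
    _ = C * profile G t a (window N l) ^ 2 := by rw [hprof]

/-- Consistency: the conditional stub is consumed as `stub_bubble_of_etaBounds hη hη0 hη2`, whose type is the
registered statement of `stub_bubble` verbatim. -/
example {η : ℝ} (hη : HasIsingEtaBounds 3 η) (hη0 : 0 ≤ η) (hη2 : η < 1 / 2) :
    ∃ C : ℝ, 0 < C ∧ ∀ l : ℕ, 1 ≤ l → ∃ N₀ : ℕ, ∀ N : ℕ, N₀ ≤ N → ∀ a : Fin 4 → ↥(box 3 N),
      (∀ i, ((a i : Site 3)) = (l : ℤ) • tetra i) →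
      (let G := ((zdGraph 3).comap (Subtype.val : ↥(box 3 N) → Site 3));
       let t : ℝ := Real.tanh (criticalBeta 3);
       loopO1PartitionFunction G t {a 0, a 1} * loopO1PartitionFunction G t {a 2, a 3} *
           bubbleSum G t a (window N l)
         ≤ C * profile G t a (window N l) ^ 2) :=
  stub_bubble_of_etaBounds hη hη0 hη2

end Summit.CriticalPhenomena.Ising3DConformalLimit.Theorems

end
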